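import Literature.NumberTheory.Automorphic.CMPrincipalSeriesSpherical        -- ★ K_v = `cmLocalIntegralLevel`, `mem_cmLocalIntegralLevel_iff_forall_v_le_one`
import Literature.NumberTheory.Automorphic.ValuedFieldValuativeRelBridge     -- ★ `v_le_one_iff_mem_integer`, `v_lt_one_iff_valuation_lt_one`
import Literature.NumberTheory.Automorphic.WhittakerTwistedJacquet           -- ★ `exists_pow_mul_mem_integer`, `pow_mul_mem_integer_of_le`
import Literature.NumberTheory.Automorphic.ReductionTheoryGLnConjugation     -- ★ `isClosed_upperUnitriangular`
import Literature.NumberTheory.Automorphic.JacquetModule                     -- ★ `IsLimitOfCompactOpen`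
import Summits.HodgeConjecture.HodgeConjecture.Theorems.F0P2nBorelCharactersUnipotent  -- ★ 3×3 bookkeeping `coe_glDiagonal_mul_mul_inv_apply`, `glDiagonal_mem_unitaryGroupOfForm`
import HarnessLib

/-!
# `N(L⁺_v)` — the unipotent radical of the Borel subgroup of `U(Φ₃)(L⁺_v)` — is the union of its compact open subgroups

Cell hodgecm-mathlib F0∕P3, crux `stmt-HodgeConjecture-24833` (`H413`); T3 «KeysCaseTwo» pay-down (stub S2 `stub_labelledPair_of_reducible` =
T3a-TREE glue G4): the HYPOTHESIS `IsLimitOfCompactOpen ↥t.N` of ★ `Representation.jacquet_exact` (exactness of the Jacquet functor,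
★ `jacquet_exact_holds`, [BernsteinZelevinsky1976, §1.7, Prop. 2.35]) DISCHARGED for the Borel triple ★ `cmBorelTriple L 3 v` of the quasi-split
`U(3)` at a finite place `v` of `L⁺` (`L` CM).  Proof ([BernsteinZelevinsky1977, §1.9]; cf. ★ `isLimitOfCompactOpen_upperUnitriangular` for `GL_n(F)`):
with `K_v = U(Φ₃)(𝒪_v)` (★ `cmLocalIntegralLevel`, compact open) and the torus elements `t_k = d(b^k, 1, b^{-k})`, `b = Nm(v) ∈ ℕ ⊂ L_v^×`
(`σ`-fixed, `|b|_w < 1` at every `w ∣ v`), the subgroups `N ∩ t_k^{-1}·K_v·t_k`… precisely `N_k = {n ∈ N : t_k n t_k⁻¹ ∈ K_v}` are compact open in `N`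
(`N` is closed), INCREASE with `k` (conjugation by `t_k` multiplies the entry `n_{ij}`, `i < j`, by `b^{k(j−i)}`… by `b^{k e_{ij}}`, `e = (1, 2; 1)`) and
EXHAUST `N` (`|b^k x|_w ≤ 1` for `k ≫ 0`); a compact `C ⊆ N` is then inside one `N_k` (directed open cover).

* §1 the entries of `t n t⁻¹` for `t = d(B, 1, B⁻¹)`, `n` upper unitriangular; monotonicity and exhaustion of the integrality condition.
* §2 `isLimitOfCompactOpen_cmUnipotentU : IsLimitOfCompactOpen ↥(cmBorelTriple L 3 v).N`.
References: [BernsteinZelevinsky1976, §1.7]; [BernsteinZelevinsky1977, §1.9]; [Rogawski1990, §1.10 p. 9]; [PlatonovRapinchuk1994, §5.1].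
-/

set_option autoImplicit false
set_option linter.dupNamespace false

noncomputable section

open NumberField IsDedekindDomain
open scoped MatrixGroups

namespace Summit.HodgeConjecture.HodgeConjecture.Cruxes.H413.F0P3UnipotentLimitCompactOpen

open Literature.NumberTheory.Automorphic Literature.NumberTheory.Automorphic.UnitaryGroup
open Summit.HodgeConjecture.HodgeConjecture.Cruxes.H413.F0P2nBorelCharactersUnipotent

/-! ## §1 Conjugating an upper unitriangular `3 × 3` matrix by `d(B, 1, B⁻¹)` -/

section Generic

variable {R : Type*} [CommRing R]

/-- The exponents `e_{ij}` with `(d(B,1,B⁻¹) n d(B,1,B⁻¹)⁻¹)_{ij} = B^{e_{ij}} n_{ij}` for upper unitriangular `n`: `e₀₁ = e₁₂ = 1`, `e₀₂ = 2`,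
`0` elsewhere (a local abbreviation spelled as a term, no definition). [cite: Rogawski1990, §1.10 p. 9] -/
theorem coe_conj_apply_of_blockTriangular (B : Rˣ) (g : GL (Fin 3) R) (hg : (g : Matrix (Fin 3) (Fin 3) R).BlockTriangular id)
    (i j : Fin 3) :
    ((glDiagonal 3 R ![B, 1, B⁻¹] * g * (glDiagonal 3 R ![B, 1, B⁻¹])⁻¹ : GL (Fin 3) R) : Matrix (Fin 3) (Fin 3) R) i j =
      (B : R) ^ ((![![0, 1, 2], ![0, 0, 1], ![0, 0, 0]] : Fin 3 → Fin 3 → ℕ) i j) * (g : Matrix (Fin 3) (Fin 3) R) i j := by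
  rw [coe_glDiagonal_mul_mul_inv_apply]
  have h10 : (g : Matrix (Fin 3) (Fin 3) R) 1 0 = 0 := hg (by decide)
  have h20 : (g : Matrix (Fin 3) (Fin 3) R) 2 0 = 0 := hg (by decide)
  have h21 : (g : Matrix (Fin 3) (Fin 3) R) 2 1 = 0 := hg (by decide)
  fin_cases i <;> fin_cases j <;>
    simp [h10, h20, h21, mul_comm, mul_assoc, mul_left_comm, pow_two]

end Generic

/-! ## §2 The CM unipotent radical is the union of its compact open subgroups -/

section CM

variable (L : Type) [Field L] [NumberField L] [IsCMField L]

omit [IsCMField L] in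
/-- Pointwise exhaustion in one factor `L_w`: if `|b|_w < 1` then `|b^k x|_w ≤ 1` for all large `k`. [cite: BernsteinZelevinsky1977, §1.9] -/
theorem exists_forall_le_v_pow_mul_le_one (v : HeightOneSpectrum (𝓞 ↥(maximalRealSubfield L))) (w : PlacesOver L v)
    {b : w.1.adicCompletion L} (hb : Valued.v b < 1) (x : w.1.adicCompletion L) :
    ∃ k : ℕ, ∀ k' : ℕ, k ≤ k' → Valued.v (b ^ k' * x) ≤ 1 := by
  have hbO := (v_le_one_iff_mem_integer b).1 hb.le
  have hbn : Literature.NumberTheory.GaloisRepresentations.IsNonarchimedeanLocalField.normAbs (w.1.adicCompletion L) b < 1 :=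
    Literature.NumberTheory.GaloisRepresentations.IsNonarchimedeanLocalField.normAbs_lt_one_iff.2
      ((v_lt_one_iff_valuation_lt_one b).1 hb)
  obtain ⟨k, hk⟩ := exists_pow_mul_mem_integer hbn x
  exact ⟨k, fun k' hk' => (v_le_one_iff_mem_integer _).2 (pow_mul_mem_integer_of_le hbO hk' hk)⟩

set_option maxHeartbeats 400000 in  -- the closing `whnf` of the long `let`-chain; 2× default, < 20 s wall
/-- **`N(L⁺_v) = ↥(cmBorelTriple L 3 v).N` is the union of its compact open subgroups** (`IsLimitOfCompactOpen`, the hypothesis of ★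
`Representation.jacquet_exact` ∕ ★ `jacquet_exact_holds`). [cite: BernsteinZelevinsky1976, §1.7, Prop. 2.35] [cite: BernsteinZelevinsky1977, §1.9]
[cite: Rogawski1990, §1.10 p. 9] -/
theorem isLimitOfCompactOpen_cmUnipotentU (v : HeightOneSpectrum (𝓞 ↥(maximalRealSubfield L))) :
    IsLimitOfCompactOpen ↥(cmBorelTriple L 3 v).N := by
  classical
  -- abbreviations
  let σ := conjLocal L (IsCMField.complexConj L) v
  let G := ↥(unitaryGroupOfForm σ (cmLocalForm L 3 v))
  let Nsg : Subgroup G := unipotentU σ (cmLocalForm L 3 v)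
  change IsLimitOfCompactOpen ↥Nsg
  intro C hC
  -- the contracting unit `b = Nm(v)`
  set Nv : ℕ := Ideal.absNorm v.asIdeal with hNv
  have hN0 : Nv ≠ 0 := fun h => v.ne_bot (Ideal.absNorm_eq_zero_iff.1 h)
  have hNL : (Nv : L) ≠ 0 := Nat.cast_ne_zero.2 hN0
  have hNw : ∀ w : PlacesOver L v, (Nv : w.1.adicCompletion L) ≠ 0 := fun w => by
    rw [← map_natCast (algebraMap L (w.1.adicCompletion L)) Nv]
    exact (map_ne_zero _).2 hNL
  have hmem : ∀ w : PlacesOver L v, (Nv : 𝓞 L) ∈ w.1.asIdeal := fun w => by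
    have h1 : (Nv : 𝓞 ↥(maximalRealSubfield L)) ∈ v.asIdeal := hNv ▸ Ideal.absNorm_mem v.asIdeal
    have h2 : (HeightOneSpectrum.under (𝓞 ↥(maximalRealSubfield L)) w.1).asIdeal = v.asIdeal :=
      congrArg HeightOneSpectrum.asIdeal w.2
    rw [← h2, HeightOneSpectrum.under_asIdeal, Ideal.under_def, Ideal.mem_comap, map_natCast] at h1
    exact h1
  have hval : ∀ w : PlacesOver L v, Valued.v ((Nv : LocalRing L v) w) < 1 := fun w => by
    rw [Pi.natCast_apply, ← map_natCast (algebraMap L (w.1.adicCompletion L)) Nv,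
      ← map_natCast (algebraMap (𝓞 L) L) Nv]
    have := (HeightOneSpectrum.valuation_lt_one_iff_mem (K := L) w.1 (Nv : 𝓞 L)).2 (hmem w)
    rwa [← HeightOneSpectrum.valuedAdicCompletion_eq_valuation' (K := L) w.1] at this
  let b : (LocalRing L v)ˣ :=
    ⟨(Nv : LocalRing L v), fun w => ((Nv : w.1.adicCompletion L))⁻¹,
      funext fun w => by rw [Pi.mul_apply, Pi.natCast_apply, Pi.one_apply, mul_inv_cancel₀ (hNw w)],
      funext fun w => by rw [Pi.mul_apply, Pi.natCast_apply, Pi.one_apply, inv_mul_cancel₀ (hNw w)]⟩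
  have hbv : ∀ w : PlacesOver L v, Valued.v ((b : LocalRing L v) w) < 1 := hval
  have hbσ : ∀ k : ℕ, σ ((b ^ k : (LocalRing L v)ˣ) : LocalRing L v) = (b ^ k : (LocalRing L v)ˣ) := fun k => by
    rw [Units.val_pow_eq_pow_val, map_pow]
    exact congrArg (· ^ k) (map_natCast σ Nv)
  -- the torus elements `t_k = d(b^k, 1, b^{-k})`
  have hJ : cmLocalForm L 3 v = (StdForm.antidiagonal 3).over (LocalRing L v) := cmLocalForm_eq_over L 3 v
  let d : ℕ → Fin 3 → (LocalRing L v)ˣ := fun k => ![b ^ k, 1, (b ^ k)⁻¹]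
  have hdmem : ∀ k, glDiagonal 3 (LocalRing L v) (d k) ∈ unitaryGroupOfForm σ (cmLocalForm L 3 v) := fun k => by
    rw [hJ]; exact glDiagonal_mem_unitaryGroupOfForm σ (b ^ k) (hbσ k)
  let t : ℕ → G := fun k => ⟨glDiagonal 3 (LocalRing L v) (d k), hdmem k⟩
  -- the compact open `K_v` and its conjugates `S_k = {g : t_k g t_k⁻¹ ∈ K_v}`
  let K₀ : Subgroup G := cmLocalIntegralLevel L 3 (Matrix.of fun i j : Fin 3 => if i.val + j.val + 1 = 3 then (1 : L) else 0) v
  have hK₀ : IsCompact (K₀ : Set G) ∧ IsOpen (K₀ : Set G) :=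
    isCompact_isOpen_cmLocalIntegralLevel L 3 (Matrix.of fun i j : Fin 3 => if i.val + j.val + 1 = 3 then (1 : L) else 0) v
  have hK₀mem : ∀ g : G, g ∈ K₀ ↔
      (∀ (i j : Fin 3) (w : PlacesOver L v), Valued.v (((g : GL (Fin 3) (LocalRing L v)).val i j) w) ≤ 1) ∧
        ∀ (i j : Fin 3) (w : PlacesOver L v), Valued.v ((((g⁻¹ : G) : GL (Fin 3) (LocalRing L v)).val i j) w) ≤ 1 :=
    fun g => mem_cmLocalIntegralLevel_iff_forall_v_le_one L 3 v g
  let S : ℕ → Subgroup G := fun k => K₀.comap (MulAut.conj (t k)).toMonoidHom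
  have hSmem : ∀ k (g : G), g ∈ S k ↔ t k * g * (t k)⁻¹ ∈ K₀ := fun k g => Iff.rfl
  have hSo : ∀ k, IsOpen (S k : Set G) := fun k =>
    hK₀.2.preimage ((continuous_const.mul continuous_id).mul continuous_const)
  have hSc : ∀ k, IsCompact (S k : Set G) := fun k => by
    have hS : S k = K₀.map (MulAut.conj (t k)).symm.toMonoidHom := Subgroup.comap_equiv_eq_map_symm' _ _
    rw [hS, Subgroup.coe_map]
    exact hK₀.1.image ((continuous_const.mul continuous_id).mul continuous_const)
  -- `N` is closed; the compact open subgroups `N_k = N ∩ S_k` of `N`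
  have hNc : IsClosed (Nsg : Set G) := (isClosed_upperUnitriangular (R := LocalRing L v)).preimage continuous_subtype_val
  let NS : ℕ → Subgroup ↥Nsg := fun k => (S k).comap Nsg.subtype
  have hNSo : ∀ k, IsOpen (NS k : Set ↥Nsg) := fun k => (hSo k).preimage continuous_subtype_val
  have hNSc : ∀ k, IsCompact (NS k : Set ↥Nsg) := fun k => hNc.isClosedEmbedding_subtypeVal.isCompact_preimage (hSc k)
  -- ENTRIES: membership of `n ∈ N` in `S_k`
  have key : ∀ (k : ℕ) (g : G), g ∈ Nsg →
      (g ∈ S k ↔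
        (∀ (i j : Fin 3) (w : PlacesOver L v),
            Valued.v ((b : LocalRing L v) w) ^ (k * (![![0, 1, 2], ![0, 0, 1], ![0, 0, 0]] : Fin 3 → Fin 3 → ℕ) i j) *
              Valued.v (((g : GL (Fin 3) (LocalRing L v)) : Matrix (Fin 3) (Fin 3) (LocalRing L v)) i j w) ≤ 1) ∧
        (∀ (i j : Fin 3) (w : PlacesOver L v),
            Valued.v ((b : LocalRing L v) w) ^ (k * (![![0, 1, 2], ![0, 0, 1], ![0, 0, 0]] : Fin 3 → Fin 3 → ℕ) i j) *
              Valued.v ((((g⁻¹ : G) : GL (Fin 3) (LocalRing L v)) : Matrix (Fin 3) (Fin 3) (LocalRing L v)) i j w) ≤ 1)) := by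
    intro k g hg
    have hg' : g⁻¹ ∈ Nsg := inv_mem hg
    have hconj : ∀ (h : G), h ∈ Nsg → ∀ (i j : Fin 3) (w : PlacesOver L v),
        Valued.v ((((t k * h * (t k)⁻¹ : G) : GL (Fin 3) (LocalRing L v)) : Matrix (Fin 3) (Fin 3) (LocalRing L v)) i j w) =
          Valued.v ((b : LocalRing L v) w) ^ (k * (![![0, 1, 2], ![0, 0, 1], ![0, 0, 0]] : Fin 3 → Fin 3 → ℕ) i j) *
            Valued.v (((h : GL (Fin 3) (LocalRing L v)) : Matrix (Fin 3) (Fin 3) (LocalRing L v)) i j w) := by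
      intro h hh i j w
      have hcoe : ((t k * h * (t k)⁻¹ : G) : GL (Fin 3) (LocalRing L v)) =
          glDiagonal 3 (LocalRing L v) (d k) * (h : GL (Fin 3) (LocalRing L v)) * (glDiagonal 3 (LocalRing L v) (d k))⁻¹ := rfl
      rw [hcoe, coe_conj_apply_of_blockTriangular (b ^ k) _ ((mem_unipotentU_iff h).1 hh).1 i j, Pi.mul_apply, Pi.pow_apply,
        map_mul, map_pow, Units.val_pow_eq_pow_val, Pi.pow_apply, map_pow, ← pow_mul]
    rw [hSmem, hK₀mem]
    have hinv : (t k * g * (t k)⁻¹)⁻¹ = t k * g⁻¹ * (t k)⁻¹ := by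
      rw [mul_inv_rev, mul_inv_rev, inv_inv, ← mul_assoc]
    rw [hinv]
    refine and_congr (forall₃_congr fun i j w => ?_) (forall₃_congr fun i j w => ?_)
    · rw [← hconj g hg i j w]
    · rw [← hconj g⁻¹ hg' i j w]
  -- MONOTONE
  have hNSmem : ∀ k (n : ↥Nsg), n ∈ NS k ↔ (n : G) ∈ S k := fun k n => Iff.rfl
  have hmono : Monotone fun k => (NS k : Set ↥Nsg) := by
    refine monotone_nat_of_le_succ fun k => ?_
    intro n hn
    rw [SetLike.mem_coe, hNSmem] at hn ⊢
    have hn' := (key k _ n.2).1 hn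
    refine (key (k + 1) _ n.2).2 ?_
    have step : ∀ (e : ℕ) (w : PlacesOver L v) (y : WithZero (Multiplicative ℤ)),
        Valued.v ((b : LocalRing L v) w) ^ (k * e) * y ≤ 1 → Valued.v ((b : LocalRing L v) w) ^ ((k + 1) * e) * y ≤ 1 := by
      intro e w y hy
      rw [add_mul, one_mul, pow_add, mul_comm (_ ^ (k * e)), mul_assoc]
      exact mul_le_one' (pow_le_one' (hbv w).le e) hy
    exact ⟨fun i j w => step _ w _ (hn'.1 i j w), fun i j w => step _ w _ (hn'.2 i j w)⟩
  -- EXHAUSTION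
  have hcover : ∀ n : ↥Nsg, ∃ k, n ∈ NS k := by
    intro n
    have hn : (n : G) ∈ Nsg := n.2
    have hn' : ((n : G)⁻¹) ∈ Nsg := inv_mem hn
    -- one exponent per (matrix, i, j, w)
    have hpt : ∀ (h : G), h ∈ Nsg → ∀ (p : Fin 3 × Fin 3 × PlacesOver L v), ∃ k : ℕ, ∀ k', k ≤ k' →
        Valued.v ((b : LocalRing L v) p.2.2) ^ (k' * (![![0, 1, 2], ![0, 0, 1], ![0, 0, 0]] : Fin 3 → Fin 3 → ℕ) p.1 p.2.1) *
          Valued.v (((h : GL (Fin 3) (LocalRing L v)) : Matrix (Fin 3) (Fin 3) (LocalRing L v)) p.1 p.2.1 p.2.2) ≤ 1 := by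
      intro h hh p
      obtain ⟨i, j, w⟩ := p
      set M : Matrix (Fin 3) (Fin 3) (LocalRing L v) := ((h : GL (Fin 3) (LocalRing L v)) : Matrix (Fin 3) (Fin 3) (LocalRing L v))
        with hM
      obtain ⟨hut, hdiag⟩ := (mem_unipotentU_iff h).1 hh
      rw [← hM] at hut hdiag
      set e : ℕ := (![![0, 1, 2], ![0, 0, 1], ![0, 0, 0]] : Fin 3 → Fin 3 → ℕ) i j with hedef
      change ∃ k : ℕ, ∀ k', k ≤ k' → Valued.v ((b : LocalRing L v) w) ^ (k' * e) * Valued.v (M i j w) ≤ 1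
      by_cases he : e = 0
      · -- diagonal or lower entry: `1` or `0`
        refine ⟨0, fun k' _ => ?_⟩
        rw [he, mul_zero, pow_zero, one_mul]
        have hij : j ≤ i := by
          rw [hedef] at he
          fin_cases i <;> fin_cases j <;> first | decide | (exfalso; simp at he)
        rcases hij.lt_or_eq with hlt | heq
        · rw [hut hlt, Pi.zero_apply, map_zero]; exact zero_le
        · rw [heq, hdiag, Pi.one_apply, map_one]
      · obtain ⟨k, hk⟩ := exists_forall_le_v_pow_mul_le_one L v w (hbv w) (M i j w)
        refine ⟨k, fun k' hk' => ?_⟩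
        have hle : k ≤ k' * e := hk'.trans (Nat.le_mul_of_pos_right k' (Nat.pos_of_ne_zero he))
        have := hk _ hle
        rwa [map_mul, map_pow] at this
    obtain ⟨k₁, hk₁⟩ := Classical.skolem.1 (hpt (n : G) hn)
    obtain ⟨k₂, hk₂⟩ := Classical.skolem.1 (hpt ((n : G)⁻¹) hn')
    refine ⟨Finset.univ.sup k₁ ⊔ Finset.univ.sup k₂, ?_⟩
    rw [hNSmem]
    refine (key _ _ hn).2 ?_
    refine ⟨fun i j w => hk₁ (i, j, w) _ ?_, fun i j w => hk₂ (i, j, w) _ ?_⟩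
    · exact (Finset.le_sup (Finset.mem_univ (i, j, w))).trans le_sup_left
    · exact (Finset.le_sup (Finset.mem_univ (i, j, w))).trans le_sup_right
  -- a compact `C` lies in one `N_k`
  obtain ⟨k, hk⟩ := hC.elim_directed_cover (fun k => (NS k : Set ↥Nsg)) hNSo
    (fun n _ => Set.mem_iUnion.2 (hcover n)) hmono.directed_le
  exact ⟨NS k, hNSo k, hNSc k, hk⟩

end CM

end Summit.HodgeConjecture.HodgeConjecture.Cruxes.H413.F0P3UnipotentLimitCompactOpen

end
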